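import Summits.BirchSwinnertonDyer.BirchSwinnertonDyer.Theorems.SignedLowerHalvesKobayashiMainConjectureSmallImageCycWindingMuThree
import Summits.BirchSwinnertonDyer.BirchSwinnertonDyer.Theorems.SmallImageMuTransferAnalyticMuZeroX9TeichOrbitNonConstantAtOfTeichSpanGenAll
import Literature.NumberTheory.EllipticCurves.PAdicLFunctionMuInvariantCertificateProofs
import HarnessLib

/-!
# Route `SignedLowerHalves`, crux `KobayashiMainConjectureSmallImage` (item stmt-BirchSwinnertonDyer-19002),
# line `birth_acns`, stub `stub_muOneSign_ns_ge5`: **the one-sign μ-rider at an odd supersingular prime from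
# Teichmüller-orbit non-constancy, and at `p ≥ 5` from Conjecture B⁰ (`TeichSpanGenAll`)**
# (cell `bsd-ssimc`, seat `bsd-line-slh-p3` gen 8; THEOREMS ONLY; helper)

What the `p ≥ 5` half of the line's one-sign μ-rider EXACTLY needs, in the tree's vocabulary:

* `exists_sign_hasUnitContent_of_teichOrbitNonConstantAt` — for `W/ℚ` globally minimal with good reduction at the odd
  prime `p` and `a_p = 0`, and its newform `f` of level `N`: `TeichOrbitNonConstantAt W p` (two Teichmüller-orbit sums
  `S_f(p,n,a) = Σ_{t^{p-1}=1} [ta/pⁿ]⁺_f`, `n ≥ 1`, differ by a rational of `p`-adic norm `≥ 1`;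
  `Rank1Residual/MuLambdaCarriers.lean`) ⟹ `∃ ε L, IsSignedPAdicLFunction f p ε L ∧ HasUnitContent L`.
  Proof: ultrametricity and `p`-integrality of `[a/pⁿ]⁺` (this seat's `…HeckePrimeMuPrelims`) make one orbit sum
  `S_f(p, n+1, b)` a `p`-adic unit; writing `b = η̄₀ γˢ` (`exists_coe_eq_toZModPow_mul_pow`, tree) and re-indexing the
  Teichmüller orbit, `S_f(p, n+1, b)` IS the coefficient of `(1+T)ˢ` in Pollack's ω⁰ Mazur–Tate element `θ_n`
  (`SmallImageOrbitSumMuThree.coeff_comp_mazurTateElement` + `teichOrbitSum_eq_finsum`, tree), and a unit coefficient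
  forces a signed Pollack function with unit content (this seat's Module 1,
  `SmallImageOrbitSumMu.exists_sign_hasUnitContent_of_norm_coeff_eq_one`, p636207).
* `exists_sign_hasUnitContent_of_teichSpanGenAll` — **the `p ≥ 5` μ-rider ⟸ Conjecture B⁰**: the tree's banked
  conjecture `TeichSpanGenAll` (cell bsd-f3-mu, `…AnalyticMuZeroX9TeichSpanDefs.lean`; OPEN, displayed as a hypothesis)
  gives `TeichOrbitNonConstantAt W p` at every good `p ≥ 5` with `E[p]` irreducible and non-constant winding symbols
  (`teichOrbitNonConstantAt_of_teichSpanGenAll`, tree); for SUPERSINGULAR `p` (`a_p = 0`) irreducibility is Serre's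
  Prop. 12 (`hasIrreducibleModPGaloisRep_of_dvd_frobeniusTrace`) and winding non-constancy is input-free
  (`EvenBranch.cycWindingNonConstantAt_of_odd`, THEOREM B road on Vaserstein's theorem proved in the tree).
* `muOneSign_ns_ge5_of_teichSpanGenAll` — the registered stub `stub_muOneSign_ns_ge5` of line `birth_acns` v10, VERBATIM,
  from `TeichSpanGenAll` (its class hypotheses `ClassX7`, `¬CM`, `¬Surj` are not used).
HONEST SCOPE: B⁰ is an OPEN conjecture (a hypothesis here, never asserted); the stub is NOT discharged — this file records
the by-name reduction «one-sign μ-rider at supersingular `p ≥ 5` ⟸ B⁰» (the same B⁰ that carries crux 19630's μ-statement);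
crux 4 stays OPEN; BSD is not proved by any of this.
References: [MazurTateTeitelbaum1986Invent] §I.10 (10.1); [Pollack2003] Def. 6.15, Rem. 6.16; [PollackWeston2011] Thm. 4.1 (1);
[Washington1997] §7.2; [Serre1972] §1.11 Prop. 12.
-/

-- D-0017: single-problem summit, the namespace repeats the problem name by design.
set_option linter.dupNamespace false
set_option autoImplicit false

noncomputable section

open scoped Classical MatrixGroups ModularForm

open Polynomial CongruenceSubgroup Literature.NumberTheory.EllipticCurves Literature.NumberTheory.EllipticCurves.ModularForms
  Literature.NumberTheory.EllipticCurves.Kobayashi2003 Literature.NumberTheory.EllipticCurves.GreenbergVatsal2000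
  Literature.NumberTheory.EllipticCurves.Rank1Residual

namespace Summit.BirchSwinnertonDyer.BirchSwinnertonDyer.Theorems.SmallImageTeichOrbitMu

open Summit.BirchSwinnertonDyer.BirchSwinnertonDyer.Theorems.SmallImageHeckePrimeMu (norm_ratPlusSymbol_intCast_div_pow_le_one)
open Summit.BirchSwinnertonDyer.BirchSwinnertonDyer.Theorems.SmallImageOrbitSumMu (exists_sign_hasUnitContent_of_norm_coeff_eq_one)
open Summit.BirchSwinnertonDyer.BirchSwinnertonDyer.Theorems.SmallImageOrbitSumMuThree (coeff_comp_mazurTateElement)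
open Summit.BirchSwinnertonDyer.BirchSwinnertonDyer.Cruxes.AnalyticMuZeroX9.TeichSpan (TeichSpanGenAll teichOrbitNonConstantAt_of_teichSpanGenAll)

variable {N : ℕ} [NeZero N] (f : CuspForm (Gamma0 N) 2) {p : ℕ} [Fact p.Prime]

/-! ## §1 A Teichmüller-orbit sum at a unit IS a group-ring coefficient of Pollack's ω⁰ Mazur–Tate element -/

omit [NeZero N] in
/-- **`S_f(p, n+1, η̄₀γˢ) = coeff_s(θ_n ∘ (T−1))`** (`p` odd, `s < pⁿ`): the Teichmüller-orbit sum at the unit `b = η̄₀ γˢ` of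
`ℤ/p^{n+1}` is the coefficient of `(1+T)ˢ` in Pollack's ω⁰ Mazur–Tate element `θ_n` (re-index the orbit by `η ↦ η η₀`).
[cite: Pollack2003, Def. 6.15 and Remark 6.16] [cite: MazurTateTeitelbaum1986Invent, §I.10 (10.1)] -/
theorem teichOrbitSum_eq_coeff_comp_mazurTateElement (hp2 : p ≠ 2) (n : ℕ) (ξ₀ : rootsOfUnity (torsionOrder p) ℤ_[p])
    {s : ℕ} (hs : s < p ^ n) (b : ZMod (p ^ (n + 1)))
    (hb : b = PadicInt.toZModPow (n + 1) ((ξ₀ : ℤ_[p]ˣ) : ℤ_[p]) * (cyclotomicGenerator p : ZMod (p ^ (n + 1))) ^ s) :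
    teichOrbitSum f p (n + 1) b = ((mazurTateElement f p n).comp (X - 1)).coeff s := by
  classical
  haveI := neZero_torsionOrder p
  haveI := Fintype.ofFinite (rootsOfUnity (torsionOrder p) ℤ_[p])
  have he : cyclotomicExponent p = 1 := by rw [cyclotomicExponent, if_neg hp2]
  rw [teichOrbitSum_eq_finsum f hp2 (by omega) b, coeff_comp_mazurTateElement f p n s hs]
  -- bring the level `n + cyclotomicExponent p` of the right-hand side to `n + 1`
  have key : ∀ k : ℕ, k = n + 1 →
      (∑ᶠ ζ : rootsOfUnity (torsionOrder p) ℤ_[p],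
        ratPlusSymbol f
          (((PadicInt.toZModPow k ((ζ : ℤ_[p]ˣ) : ℤ_[p]) * (cyclotomicGenerator p : ZMod (p ^ k)) ^ s).val : ℚ) /
            (p : ℚ) ^ k)) =
      ∑ᶠ ζ : rootsOfUnity (torsionOrder p) ℤ_[p],
        ratPlusSymbol f
          (((PadicInt.toZModPow (n + 1) ((ζ : ℤ_[p]ˣ) : ℤ_[p]) *
              (cyclotomicGenerator p : ZMod (p ^ (n + 1))) ^ s).val : ℚ) / (p : ℚ) ^ (n + 1)) := by
    rintro k rfl; rfl
  rw [key (n + cyclotomicExponent p) (by rw [he])]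
  -- re-index the orbit: `ζ = ξ ξ₀`
  rw [finsum_eq_sum_of_fintype, finsum_eq_sum_of_fintype]
  refine Fintype.sum_equiv (Equiv.mulRight ξ₀) _ _ fun ξ ↦ ?_
  have hT : PadicInt.toZModPow (n + 1) (((ξ * ξ₀ : rootsOfUnity (torsionOrder p) ℤ_[p]) : ℤ_[p]ˣ) : ℤ_[p]) =
      PadicInt.toZModPow (n + 1) ((ξ : ℤ_[p]ˣ) : ℤ_[p]) * PadicInt.toZModPow (n + 1) ((ξ₀ : ℤ_[p]ˣ) : ℤ_[p]) := by
    rw [← map_mul]; rfl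
  rw [Equiv.coe_mulRight, hT, hb, ← mul_assoc]

/-! ## §2 Orbit non-constancy ⇒ a signed Pollack function with unit content (any odd supersingular prime) -/

/-- `p`-integrality of a Teichmüller-orbit sum: `‖S_f(p,m,a)‖_p ≤ 1` (`p` odd, `p ∤ N`, `a_p(f) = 0`, newform `f`).
[cite: MazurTateTeitelbaum1986Invent, §I.10 (10.1)] -/
theorem norm_teichOrbitSum_le_one (hp2 : p ≠ 2) (hf0 : IsNewform0 f) (hpN : ¬ p ∣ N) (hap : cuspCoeff f p = ((0 : ℤ) : ℂ))
    (m : ℕ) (a : ZMod (p ^ m)) : ‖((teichOrbitSum f p m a : ℚ) : ℚ_[p])‖ ≤ 1 := by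
  rw [teichOrbitSum_def]
  push_cast
  refine IsUltrametricDist.norm_sum_le_of_forall_le_of_nonneg zero_le_one fun t _ ↦ ?_
  have h := norm_ratPlusSymbol_intCast_div_pow_le_one f hp2 hf0 hpN hap (((t * a).val : ℕ) : ℤ) m
  rwa [Int.cast_natCast] at h

/-- **Teichmüller-orbit non-constancy ⇒ `min(μ(L_p⁺), μ(L_p⁻)) = 0`** at an odd supersingular prime: for `W/ℚ` globally minimal with
good reduction at the odd prime `p`, `a_p = 0`, and its newform `f` of level `N`, `TeichOrbitNonConstantAt W p` gives a signed Pollack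
function of `f` with UNIT CONTENT.  (Ultrametricity + integrality ⇒ one orbit sum `S_f(p,n+1,b)` is a unit; `b = η̄₀γˢ`; §1 ⇒ a unit
group-ring coefficient of `θ_n`; Module 1.) [cite: MazurTateTeitelbaum1986Invent, §I.10 (10.1)] [cite: PollackWeston2011, Thm. 4.1 (1)] -/
theorem exists_sign_hasUnitContent_of_teichOrbitNonConstantAt {W : WeierstrassCurve ℚ} [W.IsElliptic] [W.IsGloballyMinimal]
    (hp2 : p ≠ 2) (hf : IsNewformOf W f) (hgood : W.HasGoodReductionAtPrime p) (hap : W.frobeniusTrace p = 0)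
    (hT : TeichOrbitNonConstantAt W p) :
    ∃ (ε : ℤˣ) (L : IwasawaAlgebra p), IsSignedPAdicLFunction f p ε L ∧ HasUnitContent L := by
  have hp : p.Prime := Fact.out
  have hpN : ¬ p ∣ N := not_dvd_level_of_isNewformOf hf hgood
  have hap' : cuspCoeff f p = ((0 : ℤ) : ℂ) := by
    rw [cuspCoeff_eq_frobeniusTrace_of_isNewformOf_holds hf hgood, hap]
  obtain ⟨m, hm, a, a', h1⟩ := hT f hf
  -- one of the two orbit sums is a `p`-adic unit
  have hone : ∃ b : (ZMod (p ^ m))ˣ, ‖((teichOrbitSum f p m (b : ZMod (p ^ m)) : ℚ) : ℚ_[p])‖ = 1 := by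
    have hmax : 1 ≤ max ‖((teichOrbitSum f p m (a : ZMod (p ^ m)) : ℚ) : ℚ_[p])‖
        ‖((teichOrbitSum f p m (a' : ZMod (p ^ m)) : ℚ) : ℚ_[p])‖ := by
      refine le_trans h1 ?_
      push_cast
      rw [sub_eq_add_neg]
      refine le_trans (IsUltrametricDist.norm_add_le_max _ _) ?_
      rw [norm_neg]
    rcases le_max_iff.mp hmax with ha | ha'
    · exact ⟨a, le_antisymm (norm_teichOrbitSum_le_one f hp2 hf.1 hpN hap' m _) ha⟩
    · exact ⟨a', le_antisymm (norm_teichOrbitSum_le_one f hp2 hf.1 hpN hap' m _) ha'⟩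
  obtain ⟨b, hb1⟩ := hone
  obtain ⟨n, rfl⟩ : ∃ n, m = n + 1 := ⟨m - 1, by omega⟩
  -- `b = η̄₀ γˢ`
  obtain ⟨ξ₀, s, hb⟩ := exists_coe_eq_toZModPow_mul_pow hp2 n b
  have hs : s.val < p ^ n := by
    haveI : NeZero (p ^ n) := ⟨pow_ne_zero _ hp.ne_zero⟩
    exact ZMod.val_lt s
  rw [teichOrbitSum_eq_coeff_comp_mazurTateElement f hp2 n ξ₀ hs (b : ZMod (p ^ (n + 1))) hb] at hb1
  exact exists_sign_hasUnitContent_of_norm_coeff_eq_one hp2 hf hgood hap hb1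

/-! ## §3 At `p ≥ 5`: the μ-rider from Conjecture B⁰ (`TeichSpanGenAll`) -/

/-- **The one-sign μ-rider at a supersingular `p ≥ 5` ⟸ B⁰.**  Assuming the tree's Conjecture B⁰ `TeichSpanGenAll`
(OPEN; a hypothesis): for `W/ℚ` globally minimal with good reduction at `p ≥ 5`, `a_p = 0`, and its newform `f` of level `N`,
`∃ ε L, IsSignedPAdicLFunction f p ε L ∧ HasUnitContent L`.  (B⁰ ⇒ `TeichOrbitNonConstantAt W p`, given `E[p]` irreducible —
Serre Prop. 12 at a supersingular prime — and winding non-constancy — input-free THEOREM B road; then §2.)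
[cite: Serre1972, §1.11 Prop. 12] [cite: MazurTateTeitelbaum1986Invent, §I.10 (10.1)] -/
theorem exists_sign_hasUnitContent_of_teichSpanGenAll (hB : TeichSpanGenAll) {W : WeierstrassCurve ℚ} [W.IsElliptic]
    [W.IsGloballyMinimal] (hp5 : 5 ≤ p) (hf : IsNewformOf W f) (hgood : W.HasGoodReductionAtPrime p)
    (hap : W.frobeniusTrace p = 0) :
    ∃ (ε : ℤˣ) (L : IwasawaAlgebra p), IsSignedPAdicLFunction f p ε L ∧ HasUnitContent L := by
  have hp2 : p ≠ 2 := by omega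
  have hirr : W.HasIrreducibleModPGaloisRep p :=
    hasIrreducibleModPGaloisRep_of_dvd_frobeniusTrace W p hp2
      (W.not_dvd_minimalDiscriminantInt_of_hasGoodReductionAtPrime' p hgood) (by rw [hap]; exact dvd_zero _)
  have hcyc : CycWindingNonConstantAt W p :=
    Summit.BirchSwinnertonDyer.BirchSwinnertonDyer.Rank1Residual.EvenBranch.cycWindingNonConstantAt_of_odd W p hp2 hgood hirr
  exact exists_sign_hasUnitContent_of_teichOrbitNonConstantAt f hp2 hf hgood hap
    (teichOrbitNonConstantAt_of_teichSpanGenAll hB W p hp5 hgood hirr hcyc)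

/-- **`stub_muOneSign_ns_ge5` of line `birth_acns` (v6–v10), VERBATIM, from Conjecture B⁰** (`TeichSpanGenAll`, a hypothesis):
the by-name reduction «one-sign analytic μ-rider of crux 4 at `p ≥ 5` ⟸ B⁰».  The class hypotheses are idle.
[cite: MazurTateTeitelbaum1986Invent, §I.10 (10.1)] [cite: PollackWeston2011, Thm. 4.1 (1)] -/
theorem muOneSign_ns_ge5_of_teichSpanGenAll (hB : TeichSpanGenAll) :
    ∀ (W : WeierstrassCurve ℚ) [W.IsElliptic] [W.IsGloballyMinimal] (p : ℕ) [Fact p.Prime], 5 ≤ p →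
    ClassX7 W p → ¬ W.HasCM → W.frobeniusTrace p = 0 → ¬ Surj W p →
    ∀ [NeZero (W.conductorNorm ℤ)] (f : CuspForm (Gamma0 (W.conductorNorm ℤ)) 2),
    IsNewformOf W f → ∃ (ε₀ : ℤˣ) (L₀ : IwasawaAlgebra p), IsSignedPAdicLFunction f p ε₀ L₀ ∧ HasUnitContent L₀ := by
  intro W _ _ p _ hp5 hX _ hap _ _ f hf
  exact exists_sign_hasUnitContent_of_teichSpanGenAll f hB hp5 hf hX.1.1 hap

end Summit.BirchSwinnertonDyer.BirchSwinnertonDyer.Theorems.SmallImageTeichOrbitMu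

end
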